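import Literature.Computability.QuantumComplexity.ClassicalClasses
import Literature.Computability.Complexity.SpaceProofs
import Literature.Computability.Complexity.SipserGacsLautemann
import HarnessLib

/-!
# `PP ⊆ PSPACE`, `BPP ⊆ PSPACE`, the machine form of `BPP`, `BPP ⊆ Σ₂ᵖ ∩ Π₂ᵖ` — discharges of `ClassicalClasses.lean`

Sibling proof file of `QuantumComplexity/ClassicalClasses.lean` (D-0014: named facts
`def X : Prop` are discharged as `theorem X_holds : X`). The mathematics is in
`Complexity/SpaceProofs.lean` (`PPEnum.pMajority_P_subset_PSPACE : pMajority P ⊆ PSPACE`, the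
loop machine of `Complexity/SpaceLoop.lean` iterating the majority-vote enumeration of
`Complexity/MajorityEnumeration.lean`) and in `Complexity/SipserGacsLautemann.lean`
(`sipser_gacs_lautemann : BPP ⊆ SigmaP 2 ∩ PiP 2`); since `PP := pMajority Classes.P`
(`ProbabilisticClasses.lean`), the discharges are one-liners:

* `PP_subset_PSPACE_holds : PP_subset_PSPACE` — **`PP ⊆ PSPACE`** (Gill 1977, Prop. 5.2(i); proof,
  p. 685: "every polynomial bounded Turing machine can be simulated in polynomial space, and so
  `PP ⊆ PSPACE`");
* `BPP_subset_PSPACE_holds : BPP_subset_PSPACE` — `BPP ⊆ PP ⊆ PSPACE` (`BPP_subset_PP_holds`).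
* `mem_BPP_iff_gill_holds : mem_BPP_iff_gill` — **quantum-advantage.S25**, Gill's machine
  definition of `BPP` (Gill 1977, Def. 5.1(ii), p. 685: "BPP is the class of languages recognized
  by polynomial bounded PTMs with bounded error probability", with Def. 2.8 (bounded error) and
  §5, p. 685 ("polynomial bounded": every computation on inputs of length `n` halts within `p(n)`
  steps); Arora–Barak 2009, Def. 7.2 ↔ Def. 7.3) as a characterisation of the operator class
  `BPP := bp P`. The statement is verbatim the prelude fact `Complexity.mem_BPP_iff_randAlg` with
  the language binder explicit, and that fact is proved in
  `Complexity/ProbabilisticClassesProofs.lean` (`mem_BPP_iff_randAlg_holds`, imported through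
  `SpaceProofs`): `(→)` run `(x, r) ↦ [⟨x, r⟩ ∈ L']` with exactly `p(n)` coins; `(←)` the witness
  `{w | A.run (boolUnpair w) = 1} ∈ P` by composing the machine of `A` with the re-pairing
  normaliser, and `RandAlg.pr` is the counting probability `uniformProb`. Locator note: the
  docstring of the fact cites "Gill 1977, §2 and Def. 5.2"; in the printed paper the definition of
  `BPP` is Def. 5.1(ii) (p. 685) and 5.2 is the Proposition `ZPP ⊆ BPP ⊆ PP ⊆ PSPACE` — the
  mathematics cited is the same.
* `BPP_subset_SigmaP_two_inter_PiP_two_holds : BPP_subset_SigmaP_two_inter_PiP_two` — the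
  **Sipser–Gács(–Lautemann) theorem `BPP ⊆ Σ₂ᵖ ∩ Π₂ᵖ`** (Sipser 1983, §V, the level-`2` bound
  credited there to P. Gács; Lautemann 1983; Arora–Barak 2009, Thm. 7.15). The mathematics is
  `Complexity/SipserGacsLautemann.lean` (`sipser_gacs_lautemann : BPP ⊆ SigmaP 2 ∩ PiP 2`), Sipser's
  own hashing argument assembled from proved tree results: amplification to error `1/4`
  (`PromiseBPPAmplification.lean`), Sipser's Coding Lemma (`SipserCodingLemma.lean`) deciding
  membership by the hashability of the `t`-fold product of the rejecting coin set, the `Σ₂ᵖ`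
  language `PostBPPHash.Hash` (`PostBPPHashLanguage.lean`), the closure of `Σ₂ᵖ` under
  polynomial-time preimages (`NPClosureProofs.lean`), and `co BPP = BPP` for the `Π₂ᵖ` half.

## References

* J. Gill, *Computational complexity of probabilistic Turing machines*, SIAM J. Comput. 6 (1977)
  675–695 [Gill1977] (held: `paper:doi-10-1137-0206049`): Prop. 5.2(i) and its proof, p. 685
  (PDF p. 11); Def. 5.1(ii) (`BPP`), p. 685; Def. 2.8 (bounded error probability), p. 678.
* S. Arora, B. Barak, *Computational Complexity: A Modern Approach*, CUP 2009 [AroraBarak2009]: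
  Ex. 7.7 (`BPP ⊆ PP ⊆ PSPACE`); Def. 7.2 (p. 125) and Def. 7.3 ("BPP, alternative definition",
  p. 126); Thm. 7.15 (`BPP ⊆ Σ₂ᵖ ∩ Π₂ᵖ`).
* M. Sipser, *A complexity theoretic approach to randomness*, Proc. 15th STOC (1983) 330–335
  [Sipser1983] (held: `paper:doi-10-1145-800061-808762`): §III (Coding Lemma), §V
  (`BPP ⊆ Σ₂ᵖ ∩ Π₂ᵖ`, with P. Gács).
* C. Lautemann, *BPP and the polynomial hierarchy*, Inform. Process. Lett. 17 (1983) 215–217.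
-/

namespace Literature.Computability.QuantumComplexity

open Literature.Computability.Complexity

/-- **`PP ⊆ PSPACE`** — discharge of the named fact `PP_subset_PSPACE` (`ClassicalClasses.lean`).
[cite: Gill1977, Prop. 5.2(i) (PP ⊆ PSPACE)] -/
theorem PP_subset_PSPACE_holds : PP_subset_PSPACE := PPEnum.pMajority_P_subset_PSPACE

/-- **`BPP ⊆ PSPACE`** — discharge of the named fact `BPP_subset_PSPACE` (`ClassicalClasses.lean`),
through `BPP ⊆ PP` (`BPP_subset_PP_holds`). [cite: Gill1977, Prop. 5.2(i) (BPP ⊆ PP ⊆ PSPACE)] -/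
theorem BPP_subset_PSPACE_holds : BPP_subset_PSPACE := fun _ hL =>
  PP_subset_PSPACE_holds (BPP_subset_PP_holds hL)

/-- **Gill's machine definition of `BPP`** (quantum-advantage.S25) — discharge of the named fact
`mem_BPP_iff_gill` (`ClassicalClasses.lean`): a language `L ⊆ {0,1}*` is in `BPP = bp P` iff some
probabilistic polynomial-time algorithm `A : RandAlg (List Bool) Bool` — deterministic polynomial
time in the pair `(x, r)` on every input and every coin string, tossing exactly `q |x|` coins for a
polynomial `q` — outputs the bit `[x ∈ L]` with probability at least `2/3` on every input. This is
the prelude fact `Complexity.mem_BPP_iff_randAlg` with the language binder made explicit, so the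
proof is its discharge `Complexity.mem_BPP_iff_randAlg_holds` (`ProbabilisticClassesProofs.lean`).
[Gill 1977, Def. 5.1(ii) (p. 685) with Def. 2.8; Arora–Barak 2009, Def. 7.2 ↔ Def. 7.3]
[cite: Gill1977, Def. 5.1(ii)] -/
theorem mem_BPP_iff_gill_holds : mem_BPP_iff_gill := fun _ => mem_BPP_iff_randAlg_holds

/-- **`BPP ⊆ Σ₂ᵖ ∩ Π₂ᵖ`** (Sipser–Gács; Lautemann) — discharge of the named fact
`BPP_subset_SigmaP_two_inter_PiP_two` (`ClassicalClasses.lean`) by the proved theorem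
`Literature.Computability.Complexity.sipser_gacs_lautemann` (`Complexity/SipserGacsLautemann.lean`:
amplification, Sipser's Coding Lemma, the `Σ₂ᵖ` hashing predicate, `co BPP = BPP`).
[cite: Sipser1983, §V (BPP ⊆ Σ₂ᵖ ∩ Π₂ᵖ; level 2 credited to P. Gács)] -/
theorem BPP_subset_SigmaP_two_inter_PiP_two_holds : BPP_subset_SigmaP_two_inter_PiP_two :=
  sipser_gacs_lautemann

end Literature.Computability.QuantumComplexity
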